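import Mathlib
import HarnessLib

/-!
# Route BernsteinTemperature, item `PlanarPressureAM` — file B: scalar power-series calculus

Helper file (supports item `stmt-CriticalPhenomena-10768`). One-variable real power series
`∑ aₙ zⁿ` packaged through `FormalMultilinearSeries.ofScalars ℝ a`:

* conversions between `HasFPowerSeriesOnBall f (ofScalars ℝ a) 0 r`, the pointwise sums
  `HasSum (fun n => a n * z ^ n) (f z)` and the germ form `∀ᶠ z in 𝓝 0, HasSum … (f z)`;
* the series of `deriv f` (coefficients `(n+1) a (n+1)`) and of `z * f z` (shifted coefficients),
  on balls and as germs;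
* uniqueness of germ coefficients and the value `f 0 = a 0`;
* radius from a geometric coefficient bound, and the passage germ → `HasSum` on an interval on
  which `f` is analytic (identity theorem).

Everything here is routine Mathlib glue (`hasFPowerSeriesAt_iff`, `coeff_ofScalars`,
`HasFPowerSeriesOnBall.fderiv`, `derivSeries_coeff_one`,
`AnalyticOnNhd.eqOn_of_preconnected_of_eventuallyEq`).
-/

namespace Summit.CriticalPhenomena.Ising3DConformalLimit.Theorems

open Filter Topology FormalMultilinearSeries
open scoped ENNReal NNReal

/-- Two one-variable formal multilinear series with the same scalar coefficients are equal.
[folklore] -/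
theorem planarPressureAM_fms_ext {p q : FormalMultilinearSeries ℝ ℝ ℝ}
    (h : ∀ n, p.coeff n = q.coeff n) : p = q := by
  funext n
  rw [← mkPiRing_coeff_eq p n, ← mkPiRing_coeff_eq q n, h n]

/-- Pointwise sums inside the ball of a power series with scalar coefficients. [folklore] -/
theorem planarPressureAM_onBall_hasSum {f : ℝ → ℝ} {a : ℕ → ℝ} {R : ℝ}
    (h : HasFPowerSeriesOnBall f (ofScalars ℝ a) 0 (ENNReal.ofReal R)) {z : ℝ} (hz : |z| < R) :
    HasSum (fun n => a n * z ^ n) (f z) := by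
  have hz' : z ∈ Metric.eball (0 : ℝ) (ENNReal.ofReal R) := by
    rw [Metric.mem_eball, edist_lt_ofReal, dist_zero_right, Real.norm_eq_abs]
    exact hz
  have := h.hasSum hz'
  simpa [ofScalars_apply_eq, smul_eq_mul, zero_add, mul_comm (a _)] using this

/-- The germ form of a power series at `0` with scalar coefficients. [folklore] -/
theorem planarPressureAM_germ_iff {f : ℝ → ℝ} {a : ℕ → ℝ} :
    (∀ᶠ z in 𝓝 (0 : ℝ), HasSum (fun n => a n * z ^ n) (f z)) ↔
      HasFPowerSeriesAt f (ofScalars ℝ a) 0 := by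
  rw [hasFPowerSeriesAt_iff]
  simp only [coeff_ofScalars, smul_eq_mul, zero_add, mul_comm (a _)]

/-- Uniqueness of germ coefficients. [folklore] -/
theorem planarPressureAM_germ_unique {f : ℝ → ℝ} {a b : ℕ → ℝ}
    (ha : ∀ᶠ z in 𝓝 (0 : ℝ), HasSum (fun n => a n * z ^ n) (f z))
    (hb : ∀ᶠ z in 𝓝 (0 : ℝ), HasSum (fun n => b n * z ^ n) (f z)) : a = b := by
  have h := (planarPressureAM_germ_iff.mp ha).eq_formalMultilinearSeries
    (planarPressureAM_germ_iff.mp hb)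
  funext n
  have := congrArg (fun p : FormalMultilinearSeries ℝ ℝ ℝ => p.coeff n) h
  simpa [coeff_ofScalars] using this

/-- The value at the centre is the zeroth coefficient. [folklore] -/
theorem planarPressureAM_germ_apply_zero {f : ℝ → ℝ} {a : ℕ → ℝ}
    (ha : ∀ᶠ z in 𝓝 (0 : ℝ), HasSum (fun n => a n * z ^ n) (f z)) : f 0 = a 0 := by
  have h0 : HasSum (fun n => a n * (0 : ℝ) ^ n) (f 0) := ha.self_of_nhds
  have h1 : HasSum (fun n => a n * (0 : ℝ) ^ n) (a 0) := by
    have : (fun n => a n * (0 : ℝ) ^ n) = fun n => if n = 0 then a 0 else 0 := by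
      funext n; rcases n with _ | n <;> simp
    rw [this]; exact hasSum_ite_eq 0 (a 0)
  exact h0.unique h1

/-- An analytic germ has scalar Taylor coefficients. [folklore] -/
theorem planarPressureAM_germ_of_analyticAt {f : ℝ → ℝ} (hf : AnalyticAt ℝ f 0) :
    ∃ a : ℕ → ℝ, ∀ᶠ z in 𝓝 (0 : ℝ), HasSum (fun n => a n * z ^ n) (f z) := by
  obtain ⟨p, hp⟩ := hf
  refine ⟨fun n => p.coeff n, ?_⟩
  have := hasFPowerSeriesAt_iff.mp hp
  simpa only [smul_eq_mul, zero_add, mul_comm (p.coeff _)] using this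


/-- Radius of convergence from a geometric coefficient bound `|aₙ| Rⁿ ≤ C`. [folklore] -/
theorem planarPressureAM_radius_ge {a : ℕ → ℝ} {R C : ℝ} (hR : 0 ≤ R)
    (hC : ∀ n, |a n| * R ^ n ≤ C) : ENNReal.ofReal R ≤ (ofScalars ℝ a).radius := by
  rw [ENNReal.ofReal_eq_coe_nnreal hR]
  exact (ofScalars ℝ a).le_radius_of_bound C fun n => by
    simpa [ofScalars_norm, Real.norm_eq_abs, NNReal.coe_mk] using hC n

/-- The sum function of `ofScalars ℝ a` on a real ball inside the disc of convergence.
[folklore] -/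
theorem planarPressureAM_tsum_hasFPowerSeriesOnBall {a : ℕ → ℝ} {R : ℝ} (hR : 0 < R)
    (h : ENNReal.ofReal R ≤ (ofScalars ℝ a).radius) :
    HasFPowerSeriesOnBall (fun z => ∑' n, a n * z ^ n) (ofScalars ℝ a) 0 (ENNReal.ofReal R) := by
  have hpos : 0 < (ofScalars ℝ a).radius := lt_of_lt_of_le (ENNReal.ofReal_pos.2 hR) h
  have h1 := ((ofScalars ℝ a).hasFPowerSeriesOnBall hpos).mono (ENNReal.ofReal_pos.2 hR) h
  have hfun : (ofScalars ℝ a).sum = fun z : ℝ => ∑' n, a n * z ^ n := by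
    funext z
    rw [FormalMultilinearSeries.sum]
    exact tsum_congr fun n => by rw [ofScalars_apply_eq, smul_eq_mul]
  rw [hfun] at h1
  exact h1

/-- The power series of the derivative: coefficients `(n+1) a (n+1)`, same ball. [folklore] -/
theorem planarPressureAM_deriv_onBall {f : ℝ → ℝ} {a : ℕ → ℝ} {r : ℝ≥0∞}
    (h : HasFPowerSeriesOnBall f (ofScalars ℝ a) 0 r) :
    HasFPowerSeriesOnBall (deriv f) (ofScalars ℝ (fun n : ℕ => ((n : ℝ) + 1) * a (n + 1))) 0 r := by
  have h1 := h.fderiv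
  set ev : (ℝ →L[ℝ] ℝ) →L[ℝ] ℝ := ContinuousLinearMap.apply ℝ ℝ (1 : ℝ) with hev
  have h2 := ev.comp_hasFPowerSeriesOnBall h1
  have hfun : (ev ∘ fderiv ℝ f) = deriv f := by
    funext z
    simp [hev]
  have hser : ev.compFormalMultilinearSeries (ofScalars ℝ a).derivSeries =
      ofScalars ℝ (fun n : ℕ => ((n : ℝ) + 1) * a (n + 1)) := by
    apply planarPressureAM_fms_ext
    intro n
    have hd := (ofScalars ℝ a).derivSeries_coeff_one n
    rw [coeff_ofScalars] at hd
    rw [coeff_ofScalars]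
    change ev (((ofScalars ℝ a).derivSeries n) 1) = _
    rw [hev, ContinuousLinearMap.apply_apply]
    change ((ofScalars ℝ a).derivSeries.coeff n) 1 = _
    rw [hd, nsmul_eq_mul]
    push_cast
    ring
  rw [hfun, hser] at h2
  exact h2

/-- Germ version of `planarPressureAM_deriv_onBall`. [folklore] -/
theorem planarPressureAM_deriv_germ {f : ℝ → ℝ} {a : ℕ → ℝ}
    (ha : ∀ᶠ z in 𝓝 (0 : ℝ), HasSum (fun n => a n * z ^ n) (f z)) :
    ∀ᶠ z in 𝓝 (0 : ℝ), HasSum (fun n : ℕ => ((n : ℝ) + 1) * a (n + 1) * z ^ n) (deriv f z) := by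
  obtain ⟨r, hr⟩ := planarPressureAM_germ_iff.mp ha
  exact planarPressureAM_germ_iff.mpr ⟨r, planarPressureAM_deriv_onBall hr⟩

/-- Shifting the coefficients does not decrease the radius of convergence. [folklore] -/
theorem planarPressureAM_radius_shift {a b : ℕ → ℝ} (hb : ∀ n, b (n + 1) = a n) :
    (ofScalars ℝ a).radius ≤ (ofScalars ℝ b).radius := by
  refine ENNReal.le_of_forall_nnreal_lt fun r hr => ?_
  have hs := (ofScalars ℝ a).summable_norm_mul_pow hr
  apply le_radius_of_summable
  rw [← summable_nat_add_iff 1]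
  have : (fun n => ‖ofScalars ℝ b (n + 1)‖ * (r : ℝ) ^ (n + 1)) =
      fun n => (r : ℝ) * (‖ofScalars ℝ a n‖ * (r : ℝ) ^ n) := by
    funext n
    rw [ofScalars_norm, ofScalars_norm, hb n]
    ring
  rw [this]
  exact hs.mul_left _

/-- Multiplication by `z` at a single point: shifted coefficients. [folklore] -/
theorem planarPressureAM_hasSum_shift {a b : ℕ → ℝ} {z S : ℝ}
    (h : HasSum (fun n => a n * z ^ n) S) (hb0 : b 0 = 0) (hb : ∀ n, b (n + 1) = a n) :
    HasSum (fun n => b n * z ^ n) (z * S) := by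
  have e : (fun n => b (n + 1) * z ^ (n + 1)) = fun n => z * (a n * z ^ n) := by
    funext n; rw [hb n]; ring
  have h2 : HasSum (fun n => b (n + 1) * z ^ (n + 1)) (z * S) := by
    rw [e]; exact h.mul_left z
  have h3 := HasSum.zero_add (f := fun n => b n * z ^ n) h2
  simpa [hb0] using h3

/-- Multiplication by `z`: shifted coefficients, same ball. [folklore] -/
theorem planarPressureAM_mul_onBall {f : ℝ → ℝ} {a b : ℕ → ℝ} {r : ℝ≥0∞}
    (h : HasFPowerSeriesOnBall f (ofScalars ℝ a) 0 r) (hb0 : b 0 = 0)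
    (hb : ∀ n, b (n + 1) = a n) :
    HasFPowerSeriesOnBall (fun z => z * f z) (ofScalars ℝ b) 0 r := by
  refine ⟨h.r_le.trans (planarPressureAM_radius_shift hb), h.r_pos, fun {y} hy => ?_⟩
  have h1 := h.hasSum hy
  simp only [ofScalars_apply_eq, smul_eq_mul, zero_add] at h1 ⊢
  exact planarPressureAM_hasSum_shift h1 hb0 hb

/-- Multiplication by `z`, germ version. [folklore] -/
theorem planarPressureAM_mul_germ {f : ℝ → ℝ} {a b : ℕ → ℝ}
    (ha : ∀ᶠ z in 𝓝 (0 : ℝ), HasSum (fun n => a n * z ^ n) (f z)) (hb0 : b 0 = 0)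
    (hb : ∀ n, b (n + 1) = a n) :
    ∀ᶠ z in 𝓝 (0 : ℝ), HasSum (fun n => b n * z ^ n) (z * f z) := by
  filter_upwards [ha] with z hz
  exact planarPressureAM_hasSum_shift hz hb0 hb

/-- From the germ to the whole interval: if `f` is analytic on an open interval around `0`, its
germ at `0` is `∑ aₙ zⁿ`, and `|aₙ| Rⁿ ≤ C`, then `∑ aₙ zⁿ = f z` for every `z` of the interval with
`|z| < R` (identity theorem). [folklore] -/
theorem planarPressureAM_hasSum_of_analyticOnNhd {f : ℝ → ℝ} {a : ℕ → ℝ} {α β R C : ℝ}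
    (hf : AnalyticOnNhd ℝ f (Set.Ioo α β)) (hα : α < 0) (hβ : 0 < β)
    (ha : ∀ᶠ z in 𝓝 (0 : ℝ), HasSum (fun n => a n * z ^ n) (f z))
    (hR : 0 < R) (hC : ∀ n, |a n| * R ^ n ≤ C) :
    ∀ z ∈ Set.Ioo α β, |z| < R → HasSum (fun n => a n * z ^ n) (f z) := by
  have hrad := planarPressureAM_radius_ge hR.le hC
  have hg := planarPressureAM_tsum_hasFPowerSeriesOnBall hR hrad
  set g : ℝ → ℝ := fun z => ∑' n, a n * z ^ n with hg_def
  set U : Set ℝ := Set.Ioo (max α (-R)) (min β R) with hU_def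
  have hUsub : U ⊆ Set.Ioo α β := fun z hz =>
    ⟨lt_of_le_of_lt (le_max_left _ _) hz.1, lt_of_lt_of_le hz.2 (min_le_left _ _)⟩
  have hUabs : ∀ z ∈ U, |z| < R := fun z hz => by
    rw [abs_lt]
    exact ⟨by linarith [le_max_right α (-R), hz.1], by linarith [min_le_right β R, hz.2]⟩
  have hgU : AnalyticOnNhd ℝ g U := fun z hz => by
    apply hg.analyticAt_of_mem
    rw [Metric.mem_eball, edist_lt_ofReal, dist_zero_right, Real.norm_eq_abs]
    exact hUabs z hz
  have hfU : AnalyticOnNhd ℝ f U := hf.mono hUsub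
  have h0U : (0 : ℝ) ∈ U := ⟨max_lt hα (by linarith), lt_min hβ hR⟩
  have hfg : f =ᶠ[𝓝 0] g := by
    have hball : ∀ᶠ z in 𝓝 (0 : ℝ), |z| < R := by
      have : Metric.ball (0 : ℝ) R ∈ 𝓝 (0 : ℝ) := Metric.ball_mem_nhds 0 hR
      filter_upwards [this] with z hz
      simpa [Metric.mem_ball, Real.dist_eq] using hz
    filter_upwards [ha, hball] with z hz hzR
    exact hz.unique (planarPressureAM_onBall_hasSum hg hzR)
  have heq := hfU.eqOn_of_preconnected_of_eventuallyEq hgU isPreconnected_Ioo h0U hfg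
  intro z hz hzR
  have hzU : z ∈ U := by
    rw [abs_lt] at hzR
    exact ⟨max_lt hz.1 hzR.1, lt_min hz.2 hzR.2⟩
  rw [heq hzU]
  exact planarPressureAM_onBall_hasSum hg (hUabs z hzU)


/-- Multiplication by `z ^ k`, germ version: coefficients shifted by `k` (zero below `k`).
[folklore] -/
theorem planarPressureAM_pow_mul_germ {f : ℝ → ℝ} {a : ℕ → ℝ}
    (ha : ∀ᶠ z in 𝓝 (0 : ℝ), HasSum (fun n => a n * z ^ n) (f z)) (k : ℕ) :
    ∀ᶠ z in 𝓝 (0 : ℝ), HasSum (fun n => (if n < k then 0 else a (n - k)) * z ^ n)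
      (z ^ k * f z) := by
  induction k with
  | zero => simpa using ha
  | succ k ih =>
    have h := planarPressureAM_mul_germ ih
      (b := fun n => if n < k + 1 then 0 else a (n - (k + 1))) (by simp) (fun n => by
        by_cases hn : n < k
        · simp [hn, show n + 1 < k + 1 from Nat.succ_lt_succ hn]
        · simp [hn, show ¬ (n + 1 < k + 1) from fun h' => hn (Nat.lt_of_succ_lt_succ h'),
            Nat.succ_sub_succ])
    filter_upwards [h] with z hz
    have e : z ^ (k + 1) * f z = z * (z ^ k * f z) := by ring
    rw [e]
    simpa [Nat.lt_succ_iff] using hz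

/-- The germ of a polynomial `∑_{i < d} qᵢ zⁱ`. [folklore] -/
theorem planarPressureAM_poly_germ (q : ℕ → ℝ) (d : ℕ) :
    ∀ᶠ z in 𝓝 (0 : ℝ), HasSum (fun n => (if n < d then q n else 0) * z ^ n)
      (∑ i ∈ Finset.range d, q i * z ^ i) := by
  refine Filter.Eventually.of_forall fun z => ?_
  have h : HasSum (fun n => (if n < d then q n else 0) * z ^ n)
      (∑ i ∈ Finset.range d, (if i < d then q i else 0) * z ^ i) :=
    hasSum_sum_of_ne_finset_zero (fun n hn => by
      have : ¬ n < d := by simpa [Finset.mem_range] using hn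
      simp [this])
  have e : (∑ i ∈ Finset.range d, (if i < d then q i else 0) * z ^ i)
      = ∑ i ∈ Finset.range d, q i * z ^ i :=
    Finset.sum_congr rfl fun i hi => by simp [Finset.mem_range.mp hi]
  rw [e] at h
  exact h

end Summit.CriticalPhenomena.Ising3DConformalLimit.Theorems
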